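import Mathlib.GroupTheory.Perm.Fin
import Literature.IUT.HodgeTheaters.ConjugacyIndeterminacies
import HarnessLib

/-!
# [IUTchI] Remark 4.5.1 (iii): where the abstract factorization-rigidity predicate HOLDS (proof-only)

Mochizuki, *Inter-universal Teichmüller theory I*, §4 (kurims May-2020 manuscript), Remark 4.5.1 (iii)
p. 110: at `v ∈ 𝕍^bad`, for the triple `J ⊆ H ⊆ G` of Example 4.5 (i) (`G = π₁(𝒟^⊚)`, `H =` the image of
`π₁(𝒟_{v_j})`, `J =` an open subgroup of a cuspidal inertia group) "a factorization `J ↪ H ↪ G` is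
uniquely determined by the composite `J ↪ G`" (supplied by Cor. 2.5).  `ConjugacyIndeterminacies.lean`
(abc-iut layer L5) types the asserted property as the ABSTRACT predicate `Rmk451.FactorizationRigid H J`
on a pair of subgroups; the abc-iut FACT-LIST row **F-1959** carries it, and its universal closure is
already refuted in the tree at `𝔖₃ ⊇ ⟨(0 1)⟩ ⊇ 1` (`FactListClosureRefutations.not_factorizationRigid_perm`,
abc-iut-w4-d068) — the predicate is a SCHEMA.  This PROOF-ONLY file supplies the positive side the row's
bookkeeping asks for ("instance forms … model-witnessed"), by elementary group theory:

* `Rmk451.factorizationRigid_of_malnormal` — the transparent MECHANISM: if `H` is malnormal in `G`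
  (`H ∩ H^g = 1` for `g ∉ H`) and `1 ≠ J ⊆ H`, then `FactorizationRigid H J` (a `G`-conjugate of `J`
  inside `H`, or a `G`-conjugate of `H` containing `J`, meets `H` nontrivially, forcing `g ∈ H`);
* `Rmk451.factorizationRigid_self_of_finite` — for `H` of finite order, `FactorizationRigid H H`
  (a conjugate of `H` comparable with `H` equals `H`, by cardinality);
* `Rmk451.factorizationRigid_perm_swap` — the MODEL instance `G = 𝔖₃`, `H = J = ⟨(0 1)⟩`, next to
  w4-d068's refuting instance `J = 1` in the same group.

Nothing here concerns the genuine triple of Example 4.5 (i) (Cor. 2.5, layer L5-t1, not in the tree);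
no side is taken on [IUTchIII] Cor. 3.12; typed ≠ proved. [claim: Mochizuki2012, status: disputed]
-/

namespace Literature.IUT.HodgeTheaters

namespace Rmk451

variable {G : Type*} [Group G]

/-- Conjugating `H` by one of its own elements gives back `H`: `H^h = H` for `h ∈ H`. [folklore] -/
private theorem conjSubgroup_eq_self_of_mem (H : Subgroup G) {h : G} (hh : h ∈ H) : conjSubgroup H h = H := by
  ext x
  simp only [conjSubgroup, Subgroup.mem_map, MulEquiv.coe_toMonoidHom, MulAut.conj_apply]
  constructor
  · rintro ⟨y, hy, rfl⟩
    exact H.mul_mem (H.mul_mem hh hy) (H.inv_mem hh)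
  · intro hx
    exact ⟨h⁻¹ * x * h, H.mul_mem (H.mul_mem (H.inv_mem hh) hx) hh, by group⟩

/-- `J ⊆ H ⟹ J^g ⊆ H^g`. [folklore] -/
private theorem conjSubgroup_mono {J H : Subgroup G} (hJH : J ≤ H) (g : G) :
    conjSubgroup J g ≤ conjSubgroup H g :=
  Subgroup.map_mono hJH

/-- `J^g = 1 ⟹ J = 1`. [folklore] -/
private theorem eq_bot_of_conjSubgroup_eq_bot {J : Subgroup G} {g : G} (h : conjSubgroup J g = ⊥) : J = ⊥ := by
  rwa [conjSubgroup, Subgroup.map_eq_bot_iff_of_injective _ (MulAut.conj g).injective] at h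

/-- **The malnormality mechanism behind [IUTchI] Remark 4.5.1 (iii)**: if `H ⊆ G` is malnormal
(`H ∩ H^g = 1` for every `g ∉ H`) and `J ⊆ H` is nontrivial, then the triple `J ⊆ H ⊆ G` is
factorization-rigid — "a factorization `J ↪ H ↪ G` is uniquely determined by the composite `J ↪ G`":
every `G`-conjugate of `J` lying in `H` is an `H`-conjugate of `J`, and every `G`-conjugate of `H`
containing `J` is `H` (in both cases the conjugator is forced into `H`).  An abstract sufficient
criterion for the typed predicate; that the triple of Example 4.5 (i) is rigid is Cor. 2.5, not this.
([IUTchI] Rmk 4.5.1 (iii) p.110) [claim: Mochizuki2012, status: disputed] -/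
theorem factorizationRigid_of_malnormal {H J : Subgroup G}
    (hmal : ∀ g : G, g ∉ H → H ⊓ conjSubgroup H g = ⊥) (hJH : J ≤ H) (hJ : J ≠ ⊥) :
    FactorizationRigid H J := by
  -- a conjugator carrying `J` into `H` lies in `H`
  have key : ∀ g : G, conjSubgroup J g ≤ H → g ∈ H := fun g hg => by
    by_contra hgH
    exact hJ (eq_bot_of_conjSubgroup_eq_bot (le_bot_iff.mp
      ((le_inf hg (conjSubgroup_mono hJH g)).trans (hmal g hgH).le)))
  refine ⟨fun g hg => ⟨g, key g hg, rfl⟩, fun g hg => ?_⟩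
  -- a conjugate of `H` containing `J` meets `H` in `J ≠ 1`, so the conjugator lies in `H`
  have hgH : g ∈ H := by
    by_contra hgH
    exact hJ (le_bot_iff.mp ((le_inf hJH hg).trans (hmal g hgH).le))
  exact conjSubgroup_eq_self_of_mem H hgH

/-- **A model family for [IUTchI] Remark 4.5.1 (iii) as typed**: for a subgroup `H` of finite order
and `J = H`, the triple `H ⊆ H ⊆ G` is factorization-rigid — a conjugate `H^g` comparable with `H`
has the same finite cardinality, hence equals `H = H^1`.
([IUTchI] Rmk 4.5.1 (iii) p.110) [claim: Mochizuki2012, status: disputed] -/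
theorem factorizationRigid_self_of_finite (H : Subgroup G) [Finite H] : FactorizationRigid H H := by
  have hcard : ∀ g : G, Nat.card (conjSubgroup H g) = Nat.card H := fun g =>
    Subgroup.card_map_of_injective (MulAut.conj g).injective
  have h1 : ∀ g : G, conjSubgroup H g ≤ H → conjSubgroup H g = H := fun g hle =>
    Subgroup.eq_of_le_of_card_ge hle (hcard g).ge
  refine ⟨fun g hg => ⟨1, H.one_mem, ?_⟩, fun g hle => ?_⟩
  · rw [h1 g hg, conjSubgroup_eq_self_of_mem H H.one_mem]
  · haveI : Finite (conjSubgroup H g) :=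
      Nat.finite_of_card_ne_zero (by rw [hcard g]; exact Nat.card_pos.ne')
    exact (Subgroup.eq_of_le_of_card_ge hle (hcard g).le).symm

/-- **The model instance in `𝔖₃`**: `G = 𝔖₃`, `H = J = ⟨(0 1)⟩` is factorization-rigid (companion to
the refuting instance `H = ⟨(0 1)⟩`, `J = 1` of `FactListClosureRefutations.not_factorizationRigid_perm`:
the typed predicate F-1959 is a schema, true at some data and false at others).
([IUTchI] Rmk 4.5.1 (iii) p.110) [claim: Mochizuki2012, status: disputed] -/
theorem factorizationRigid_perm_swap :
    FactorizationRigid (Subgroup.zpowers (Equiv.swap (0 : Fin 3) 1))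
      (Subgroup.zpowers (Equiv.swap (0 : Fin 3) 1)) :=
  factorizationRigid_self_of_finite _

end Rmk451

end Literature.IUT.HodgeTheaters
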